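import Mathlib
import Summits.NavierStokesRegularity.NavierStokesRegularity.Theorems.TaoLadderRungThreeRestartGlue
import Summits.NavierStokesRegularity.NavierStokesRegularity.Theses.TaoLadderRungTwoPoly
import HarnessLib

/-!
# `TaoLadderRungTwoPoly.RestartGlue` (item stmt-NavierStokesRegularity-20651)

The support `RestartGlue` of route `TaoLadderRungTwoPoly` is, character for character, the shared
support `RestartGlue` of routes `TaoLadderRungThree` / `TaoLadderRungTwo`
(item stmt-NavierStokesRegularity-20425), already proved in the tree as
`Theorems.RestartGlue.epochCheckpoints_succ` (file `TaoLadderRungThreeRestartGlue.lean`): a `StepTo`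
of the flow restarted at checkpoint `(N, t_N, e_N)` is a level-`N+1` `EpochCheckpoints` of the
original family with `t_{N+1} = t_N + τ₁/γ`, `e_{N+1} = a · e_N`. This file closes the new item by
that theorem.

HONEST FRAMING: definitional bookkeeping about Tao-type MODEL lattice pseudo-flows (Tao 2016 §6);
nothing here is a statement about the Navier–Stokes equations, and the route's rung leaf is not the
summit Statement.
-/

noncomputable section

set_option linter.dupNamespace false

namespace Summit.NavierStokesRegularity.NavierStokesRegularity.Theorems

open RestartGlue in
/-- **Item stmt-NavierStokesRegularity-20651** (`TaoLadderRungTwoPoly.RestartGlue`): a `StepTo` of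
the restarted flow is a level-`N+1` `EpochCheckpoints` of the original family — the statement of
the shared support stmt-NavierStokesRegularity-20425 read in route `TaoLadderRungTwoPoly`, closed by
the tree theorem `RestartGlue.epochCheckpoints_succ`.
[cite: Tao2016AveragedNS, §6.4 with §6.2 Prop. 6.3 (vi)–(ix)] -/
theorem taoLadderRungTwoPoly_restartGlue_proof :
    Summit.NavierStokesRegularity.NavierStokesRegularity.Theses.TaoLadderRungTwoPoly.RestartGlue := by
  unfold Summit.NavierStokesRegularity.NavierStokesRegularity.Theses.TaoLadderRungTwoPoly.RestartGlue
  intro ε₀ θ c m i₀ n₀ X₀ P Q N X E t e τ₁ a hε₀ hN h hst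
  exact epochCheckpoints_succ hε₀ hN h hst

end Summit.NavierStokesRegularity.NavierStokesRegularity.Theorems

end
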